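import Summits.AtomisticToContinuum.HydrodynamicLimit.Theorems.AntiMazurCoboundariesInfluenceLocalityTrueCapsExistPrelimB
import Summits.AtomisticToContinuum.HydrodynamicLimit.Theorems.BoltzmannGreenKubo.Negative.Stationarity

/-!
# Prelim D of stub `stub_trueCapsExist` (line `true-anchored-infection`, crux `InfluenceLocality`,
# stmt-AtomisticToContinuum-13916; route AntiMazurCoboundaries): the Rice (collision-flux) bounds
# for the fast-collision sums of ONE sphere, uniformly in `N`

Under the homogeneous Gibbs law `G_N = gibbs σ a θ c N Φ` (stationary under every hard-sphere flow
`Φ`, `measurePreserving_flow_localGibbsLaw`), the collision-flux inequality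
`measure_collisionSum_ge_le_liminf` (Cercignani–Illner–Pulvirenti 1994 App. 4.A, as proved in
`KineticTheory/CollisionFluxUpperBound`) bounds the probability that a COLLISION SUM along a good
orbit reaches `1` by `liminf_M M ∫ (one-window majorant) dG_N`. This file applies it to the two
marks of STUB 4 (`TrueCapsExist`):

* `trueCaps_rice_self` (registered prelim) — mark "sphere `i` collides and is fast (`u`-far from
  the drift `c`) afterwards": `G_N{good, sum ≥ 1} ≤ 16 N ε² τ · I_fast`,
  `I_fast = ∫ ‖w - v‖ 𝟙{u < ‖v - c‖} dγ dγ`, `ε = hsDiameter σ N` (so `N ε² τ = σ² T · Nℓ³ ≤ σ² T`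
  for `τ = Tℓ`): the one-window events of `exists_windowEvent` for the pairs `(i, k)`;
* `TrueCaps.rice_other` lives in the companion Prelim E; the collision sum `TrueCaps.collSum`, the
  summand lemma `TrueCaps.le_collSum_of_contact` and the packaged pair events
  `TrueCaps.exists_pairEvents` are in Prelim B.

The tube families are those of `exists_sweptTube`; the canonical pair/triple laws are controlled
by `posGibbs_pairEvent_le` / `posGibbs_tripleEvent_le` at small reduced density.
-/

namespace Summit.AtomisticToContinuum.HydrodynamicLimit.Theorems.TrueAnchoredInfection

open MeasureTheory Set Filter Topology
open scoped ENNReal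
open Literature.Analysis.FluidPDE Literature.MathematicalPhysics.KineticTheory
open Literature.Analysis.FunctionSpaces
open Summit.AtomisticToContinuum.HydrodynamicLimit.Theorems.BoltzmannGreenKuboOrthMomentum
  (measurePreserving_flow_localGibbsLaw)

noncomputable section

open TrueCaps in
/-- **Registered prelim `trueCaps_rice_self`** (of `stub_trueCapsExist`): the Rice bound for the
fast collisions of ONE sphere. Under `G_N = gibbs σ a θ c N Φ` at small reduced density
(`a, θ > 0`, `N ≥ 1`, `τ > 0`), the probability that a good orbit has, at some collision time of
`[0, τ]`, the sphere `i` in contact and fast (`u < ‖v_i - c‖`, post-collisional velocity) is at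
most `16 N ε² τ · I_fast` (`ε = hsDiameter σ N`, `I_fast = TrueCaps.fastFlux c θ u`): stationarity
of `G_N` under the flow, the collision-flux inequality `measure_collisionSum_ge_le_liminf`, the
one-window events of `exists_windowEvent` for the `N` partners `k ≠ i`, and `M · (τ/M) = τ`. -/
theorem trueCaps_rice_self : ∀ (σ a θ : ℝ) (c : V3) (N : ℕ) (Φ : Flow σ N) (τ u : ℝ) (i : Fin (N + 1)), SmallDensity uniformProfile σ → 0 < a → 0 < θ → 1 ≤ N → 0 < τ → gibbs σ a θ c N Φ {z | z ∈ Φ.good ∧ 1 ≤ TrueCaps.collSum Φ τ (fun w i' _ => if i' = i ∧ u < ‖(w i).2 - c‖ then 1 else 0) z} ≤ ENNReal.ofReal (16 * N * hsDiameter σ N ^ 2 * τ) * TrueCaps.fastFlux c θ u := by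
  intro σ a θ c N Φ τ u i hsd ha hθ hN hτ
  classical
  set P := gibbs σ a θ c N Φ with hP
  set ε := hsDiameter σ N with hε
  -- the mark and the weight
  set F : Phase N → Fin (N + 1) → Fin (N + 1) → ℝ≥0∞ :=
    fun w i' _ => if i' = i ∧ u < ‖(w i).2 - c‖ then 1 else 0 with hF
  set A : V3 × V3 → ℝ≥0∞ := fun p => {p : V3 × V3 | u < ‖p.1 - c‖}.indicator 1 p with hA
  have hAm : Measurable A := measurable_fastWeight c u
  have hFA : ∀ w k, F w i k = A ((w i).2, (w k).2) := by
    intro w k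
    simp only [hF, hA, true_and, indicator, mem_setOf_eq, Pi.one_apply]
  -- the window events of the pairs `(i, k)`
  obtain ⟨E, hEm, hEc, hEb⟩ := exists_pairEvents hsd ha hθ c hN Φ hτ i hAm
  set E' : ℕ → Fin (N + 1) → Fin (N + 1) → Set (Phase N) := fun M i' k => if i' = i then E M k else univ with hE'
  have hE'm : ∀ M i' k, MeasurableSet (E' M i' k) := by
    intro M i' k
    by_cases h : i' = i
    · simp only [hE', if_pos h]; exact hEm M k
    · simp only [hE', if_neg h]; exact MeasurableSet.univ
  have hE'c : ∀ (M : ℕ) (i' k : Fin (N + 1)), i' ≠ k → ∀ w ∈ hardSphereDomain G3 (N + 1) ε, ∀ t ∈ Icc 0 (τ / M),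
      ‖G3.sepVec ((freeFlight G3 (-t) w i').1) ((freeFlight G3 (-t) w k).1)‖ = ε → w ∈ E' M i' k := by
    intro M i' k hik w hw t ht hc
    by_cases h : i' = i
    · subst h
      simp only [hE', if_true]
      exact hEc M k hik w hw t ht hc
    · simp only [hE', if_neg h]; exact mem_univ _
  have hFm : ∀ M (i' k : Fin (N + 1)), Measurable fun w => (fun (_ : ℕ) => F) M w i' k := by
    intro M i' k
    by_cases h : i' = i
    · subst h
      have : (fun w : Phase N => F w i' k) = fun w => A ((w i').2, (w k).2) := funext fun w => hFA w k
      simp only [this]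
      exact hAm.comp ((measurable_pi_apply i').snd.prodMk (measurable_pi_apply k).snd)
    · have : (fun w : Phase N => F w i' k) = fun _ => 0 := by
        funext w; simp only [hF, h, false_and, if_false]
      simp only [this]
      exact measurable_const
  have hFt : ∀ (M : ℕ) (i' k : Fin (N + 1)), i' ≠ k → ∀ w ∈ hardSphereDomain G3 (N + 1) ε, ∀ t ∈ Icc 0 (τ / M),
      ‖G3.sepVec ((freeFlight G3 (-t) w i').1) ((freeFlight G3 (-t) w k).1)‖ = ε →
        F (freeFlight G3 (-t) w) i' k ≤ (fun (_ : ℕ) => F) M w i' k := by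
    intro M i' k _ w _ t _ _
    simp only [hF, freeFlight_apply]
    exact le_rfl
  have hstat : ∀ t : ℝ, MeasurePreserving (Φ.flow t) P P := fun t => measurePreserving_flow_localGibbsLaw a θ c Φ t
  have hgen := measure_collisionSum_ge_le_liminf Φ P hstat hτ F E' hE'm hE'c (fun _ => F) hFm hFt
    one_ne_zero ENNReal.one_ne_top
  rw [inv_one, one_mul] at hgen
  refine hgen.trans (liminf_le_of_frequently_le' (Frequently.of_forall fun M => ?_))
  -- the mean of one window
  have hterm : ∀ i' k : Fin (N + 1), ∫⁻ w, (if i' ≠ k then (E' M i' k).indicator (fun w => F w i' k) w else 0) ∂P ≤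
      if i' = i ∧ i' ≠ k then ENNReal.ofReal (16 * ε ^ 2 * (τ / M)) * fastFlux c θ u else 0 := by
    intro i' k
    by_cases hik : i' ≠ k
    · simp only [if_pos hik]
      by_cases h : i' = i
      · subst h
        simp only [true_and, if_pos hik, hE', if_true]
        have : (fun w => (E M k).indicator (fun w => F w i' k) w) = fun w => (E M k).indicator (fun w => A ((w i').2, (w k).2)) w := by
          funext w; simp only [hFA]
        rw [this]
        exact hEb M k hik
      · have h0 : (fun w => (E' M i' k).indicator (fun w => F w i' k) w) = fun _ => 0 := by
          funext w
          simp only [hF, h, false_and, if_false]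
          exact Set.indicator_apply_eq_zero.2 fun _ => rfl
        rw [h0, lintegral_zero]
        simp [h]
    · simp only [if_neg hik, lintegral_zero]
      exact bot_le
  have hmeas : ∀ i' k : Fin (N + 1), Measurable fun w : Phase N =>
      (if i' ≠ k then (E' M i' k).indicator (fun w => F w i' k) w else 0) := by
    intro i' k
    by_cases hik : i' ≠ k
    · simp only [if_pos hik]; exact (hFm M i' k).indicator (hE'm M i' k)
    · simp only [if_neg hik]; exact measurable_const
  calc (M : ℝ≥0∞) * ∫⁻ w, ∑ i', ∑ k, (if i' ≠ k then (E' M i' k).indicator (fun w => F w i' k) w else 0) ∂P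
      = (M : ℝ≥0∞) * ∑ i', ∑ k, ∫⁻ w, (if i' ≠ k then (E' M i' k).indicator (fun w => F w i' k) w else 0) ∂P := by
        congr 1
        rw [lintegral_finsetSum _ fun i' _ => Finset.measurable_sum _ fun k _ => hmeas i' k]
        exact Finset.sum_congr rfl fun i' _ => lintegral_finsetSum _ fun k _ => hmeas i' k
    _ ≤ (M : ℝ≥0∞) * ∑ i' : Fin (N + 1), ∑ k : Fin (N + 1),
          (if i' = i ∧ i' ≠ k then ENNReal.ofReal (16 * ε ^ 2 * (τ / M)) * fastFlux c θ u else 0) := by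
        gcongr with i' _ k _
        exact hterm i' k
    _ = (M : ℝ≥0∞) * ((Finset.univ.filter fun k : Fin (N + 1) => i ≠ k).card •
          (ENNReal.ofReal (16 * ε ^ 2 * (τ / M)) * fastFlux c θ u)) := by
        congr 1
        rw [Finset.sum_eq_single i (fun i' _ hi' => by simp [hi']) (fun h => absurd (Finset.mem_univ i) h)]
        simp only [true_and]
        rw [← Finset.sum_filter, Finset.sum_const]
    _ ≤ (M : ℝ≥0∞) * (N • (ENNReal.ofReal (16 * ε ^ 2 * (τ / M)) * fastFlux c θ u)) := by
        gcongr
        have hcard : (Finset.univ.filter fun k : Fin (N + 1) => i ≠ k).card = N := by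
          have h1 : (Finset.univ.filter fun k : Fin (N + 1) => i ≠ k) = Finset.univ.erase i := by
            ext k; simp [eq_comm]
          rw [h1, Finset.card_erase_of_mem (Finset.mem_univ i), Finset.card_univ, Fintype.card_fin, Nat.add_sub_cancel]
        exact hcard.le
    _ = (N : ℝ≥0∞) * ((M : ℝ≥0∞) * ENNReal.ofReal (16 * ε ^ 2 * (τ / M))) * fastFlux c θ u := by
        rw [nsmul_eq_mul]; ring
    _ ≤ (N : ℝ≥0∞) * ENNReal.ofReal (16 * ε ^ 2 * τ) * fastFlux c θ u := by
        gcongr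
        exact natCast_mul_ofReal_div_le M _ _
    _ = ENNReal.ofReal (16 * N * ε ^ 2 * τ) * fastFlux c θ u := by
        rw [← ENNReal.ofReal_natCast N, ← ENNReal.ofReal_mul (Nat.cast_nonneg _)]
        congr 2
        ring

end

end Summit.AtomisticToContinuum.HydrodynamicLimit.Theorems.TrueAnchoredInfection
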